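import Mathlib
import Summits.Ventures.PercRepro2.Graph
import Summits.Ventures.PercRepro2.Exploration
import Summits.Ventures.PercRepro2.Harris
import Summits.Ventures.PercRepro2.GibbsPAJoint
import Summits.Ventures.PercRepro2.SepClusterJoint
import Summits.Ventures.PercRepro2.SepClusterSupport

/-!
# The separated cluster — the two monotone classes and the conditional Harris inequalities
(blind cell PercRepro2, p3 g12, 2026-08-27; `proofs/P3-G2.md` §3 Step 1, single-root form)

Part 3 of the formalisation of Theorem A of `P3-G2.md`.  `IncY` = functions of the `y`-cluster
monotone on the support of the `y`-marginal, `AntiX` = functions of the `x`-cluster antitone on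
the support of the `x`-marginal.  Given `C(x) = K` two `IncY` functions are positively correlated
(`harris_right`) and given `C(y) = D` two `AntiX` functions are positively correlated
(`harris_left`) — Harris (`expect_mul_expect_le_expect_mul`) for the monotone observables
`ω ↦ g(C_{G − K}(y)(ω))`; the conditional expectation of an `IncY` function is `AntiX`
(`antiX_condS`) and that of an `AntiX` function is `IncY` (`incY_condS_transpose`) — Lemma 4
(ii)/(iii) of the paper, through `cluster_mono`.  Own work; standard axioms.
-/

namespace Summit.Ventures.PercRepro2

namespace SepPA

open Finset Classical

section Separated

variable {V : Type*} {E : Type*} [Fintype V] [Fintype E] [DecidableEq E]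
variable (ends : E → Sym2 V) (p : E → ℝ) (x y : V)

variable {x y}

omit [Fintype V] [Fintype E] [DecidableEq E] in
/-- `touches` is monotone. -/
lemma touches_mono {K K' : Set V} (h : K ⊆ K') : touches ends K ⊆ touches ends K' := by
  rintro e ⟨a, ha, b, hab⟩
  exact ⟨a, h ha, b, hab⟩

omit [Fintype V] [Fintype E] [DecidableEq E] in
/-- Exploring away from a larger set gives a smaller cluster. -/
lemma clAway_anti {K K' : Set V} (h : K ⊆ K') (v : V) (ω : Config E) :
    clAway ends K' v ω ⊆ clAway ends K v ω := by
  unfold clAway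
  apply cluster_mono
  apply restrict_le_restrict_of_subset
  exact Set.compl_subset_compl.mpr (touches_mono ends h)

omit [Fintype V] [Fintype E] [DecidableEq E] in
/-- `clAway` is monotone in the configuration. -/
lemma clAway_mono (K : Set V) (v : V) {ω ω' : Config E} (h : ω ≤ ω') :
    clAway ends K v ω ⊆ clAway ends K v ω' := by
  unfold clAway
  exact cluster_mono (restrict_mono _ h) v

variable (x y)

/-- Functions of the `y`-cluster monotone on the support of the `y`-marginal. -/
def IncY (g : Set V → ℝ) : Prop :=
  ∀ D D' : Set V, (∑ K, J ends p x y D K) ≠ 0 → (∑ K, J ends p x y D' K) ≠ 0 → D ⊆ D' →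
    g D ≤ g D'

/-- Functions of the `x`-cluster antitone on the support of the `x`-marginal. -/
def AntiX (F : Set V → ℝ) : Prop :=
  ∀ K K' : Set V, (∑ D, J ends p x y D K) ≠ 0 → (∑ D, J ends p x y D K') ≠ 0 → K ⊆ K' →
    F K' ≤ F K

variable {x y}

omit [Fintype V] in
/-- The joint law is non-negative. -/
lemma J_nonneg (hp01 : ∀ e, 0 < p e ∧ p e < 1) (D K : Set V) : 0 ≤ J ends p x y D K :=
  div_nonneg (prob_nonneg (isProbVec_of_interior p hp01) _)
    (prob_nonneg (isProbVec_of_interior p hp01) _)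

/-- A monotone-on-the-support function of the `y`-cluster explored away from a supported
`x`-cluster is a monotone observable. -/
lemma monotone_comp_clAway (hp01 : ∀ e, 0 < p e ∧ p e < 1) (hxy : x ≠ y) {g : Set V → ℝ}
    (hg : IncY ends p x y g) {K : Set V} (hK : (∑ D, J ends p x y D K) ≠ 0) :
    Monotone (fun ω => g (clAway ends K y ω)) := by
  intro ω ω' h
  exact hg _ _ (clAway_mem_support_right ends p hp01 hxy hK ω)
    (clAway_mem_support_right ends p hp01 hxy hK ω') (clAway_mono ends K y h)

/-- An antitone-on-the-support function of the `x`-cluster explored away from a supported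
`y`-cluster is an antitone observable. -/
lemma antitone_comp_clAway (hp01 : ∀ e, 0 < p e ∧ p e < 1) (hxy : x ≠ y) {F : Set V → ℝ}
    (hF : AntiX ends p x y F) {D : Set V} (hD : (∑ K, J ends p x y D K) ≠ 0) :
    Antitone (fun ω => F (clAway ends D x ω)) := by
  intro ω ω' h
  exact hF _ _ (clAway_mem_support_left ends p hp01 hxy hD ω)
    (clAway_mem_support_left ends p hp01 hxy hD ω') (clAway_mono ends D x h)

/-- **Conditional Harris on the `y` side**: given `C(x) = K`, two functions of `IncY` are
positively correlated. -/
theorem harris_right (hp01 : ∀ e, 0 < p e ∧ p e < 1) (hxy : x ≠ y) (g₁ g₂ : Set V → ℝ)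
    (h₁ : IncY ends p x y g₁) (h₂ : IncY ends p x y g₂) (K : Set V) :
    (∑ D, J ends p x y D K * g₁ D) * (∑ D, J ends p x y D K * g₂ D) ≤
      (∑ D, J ends p x y D K * (g₁ D * g₂ D)) * (∑ D, J ends p x y D K) := by
  have hJ0 : ∀ D K, 0 ≤ J ends p x y D K := J_nonneg ends p hp01
  by_cases hQ : (∑ D, J ends p x y D K) = 0
  · have hz : ∀ D, J ends p x y D K = 0 := GibbsPAJoint.all_zero_of_sum_eq_zero hJ0 hQ
    simp [hz]
  · rw [← GibbsPAJoint.marg_mul_condS _ hJ0 g₁ K, ← GibbsPAJoint.marg_mul_condS _ hJ0 g₂ K,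
      ← GibbsPAJoint.marg_mul_condS _ hJ0 (fun D => g₁ D * g₂ D) K]
    rw [condS_eq_expect ends p hp01 hxy g₁ hQ, condS_eq_expect ends p hp01 hxy g₂ hQ,
      condS_eq_expect ends p hp01 hxy (fun D => g₁ D * g₂ D) hQ]
    have hH := expect_mul_expect_le_expect_mul (isProbVec_of_interior p hp01)
      (monotone_comp_clAway ends p hp01 hxy h₁ hQ) (monotone_comp_clAway ends p hp01 hxy h₂ hQ)
    have hQ0 : 0 ≤ (∑ D, J ends p x y D K) := Finset.sum_nonneg (fun D _ => hJ0 D K)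
    have e : expect p ((fun ω => g₁ (clAway ends K y ω)) * fun ω => g₂ (clAway ends K y ω)) =
        expect p (fun ω => g₁ (clAway ends K y ω) * g₂ (clAway ends K y ω)) := rfl
    rw [e] at hH
    calc (∑ D, J ends p x y D K) * expect p (fun ω => g₁ (clAway ends K y ω)) *
          ((∑ D, J ends p x y D K) * expect p (fun ω => g₂ (clAway ends K y ω)))
        = ((∑ D, J ends p x y D K) * (∑ D, J ends p x y D K)) *
          (expect p (fun ω => g₁ (clAway ends K y ω)) *
            expect p (fun ω => g₂ (clAway ends K y ω))) := by ring
      _ ≤ ((∑ D, J ends p x y D K) * (∑ D, J ends p x y D K)) *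
          expect p (fun ω => g₁ (clAway ends K y ω) * g₂ (clAway ends K y ω)) :=
          mul_le_mul_of_nonneg_left hH (mul_nonneg hQ0 hQ0)
      _ = _ := by ring

/-- **Conditional Harris on the `x` side**: given `C(y) = D`, two functions of `AntiX` are
positively correlated. -/
theorem harris_left (hp01 : ∀ e, 0 < p e ∧ p e < 1) (hxy : x ≠ y) (F₁ F₂ : Set V → ℝ)
    (h₁ : AntiX ends p x y F₁) (h₂ : AntiX ends p x y F₂) (D : Set V) :
    (∑ K, J ends p x y D K * F₁ K) * (∑ K, J ends p x y D K * F₂ K) ≤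
      (∑ K, J ends p x y D K * (F₁ K * F₂ K)) * (∑ K, J ends p x y D K) := by
  have hJ0 : ∀ D K, 0 ≤ J ends p x y D K := J_nonneg ends p hp01
  have hJ0' : ∀ K D, 0 ≤ GibbsPAJoint.transpose (J ends p x y) K D := fun K D => hJ0 D K
  by_cases hq : (∑ K, J ends p x y D K) = 0
  · have hz : ∀ K, J ends p x y D K = 0 := GibbsPAJoint.all_zero_of_sum_eq_zero' hJ0 hq
    simp [hz]
  · have m1 := GibbsPAJoint.marg_mul_condS (GibbsPAJoint.transpose (J ends p x y)) hJ0' F₁ D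
    have m2 := GibbsPAJoint.marg_mul_condS (GibbsPAJoint.transpose (J ends p x y)) hJ0' F₂ D
    have m12 := GibbsPAJoint.marg_mul_condS (GibbsPAJoint.transpose (J ends p x y)) hJ0'
      (fun K => F₁ K * F₂ K) D
    simp only [GibbsPAJoint.transpose] at m1 m2 m12
    rw [← m1, ← m2, ← m12]
    rw [condS_transpose_eq_expect ends p hp01 hxy F₁ hq,
      condS_transpose_eq_expect ends p hp01 hxy F₂ hq,
      condS_transpose_eq_expect ends p hp01 hxy (fun K => F₁ K * F₂ K) hq]
    -- Harris for the two antitone observables, through their negatives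
    have hmono₁ : Monotone (fun ω => (-1 : ℝ) * F₁ (clAway ends D x ω)) := by
      intro ω ω' h
      have := antitone_comp_clAway ends p hp01 hxy h₁ hq h
      simp only
      linarith
    have hmono₂ : Monotone (fun ω => (-1 : ℝ) * F₂ (clAway ends D x ω)) := by
      intro ω ω' h
      have := antitone_comp_clAway ends p hp01 hxy h₂ hq h
      simp only
      linarith
    have hH := expect_mul_expect_le_expect_mul (isProbVec_of_interior p hp01) hmono₁ hmono₂
    rw [expect_const_mul, expect_const_mul] at hH
    have e : expect p ((fun ω => (-1 : ℝ) * F₁ (clAway ends D x ω)) *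
        fun ω => (-1 : ℝ) * F₂ (clAway ends D x ω)) =
        expect p (fun ω => F₁ (clAway ends D x ω) * F₂ (clAway ends D x ω)) := by
      unfold expect
      apply Finset.sum_congr rfl
      intro ω _
      simp only [Pi.mul_apply]
      ring
    rw [e] at hH
    have hH' : expect p (fun ω => F₁ (clAway ends D x ω)) *
        expect p (fun ω => F₂ (clAway ends D x ω)) ≤
        expect p (fun ω => F₁ (clAway ends D x ω) * F₂ (clAway ends D x ω)) := by
      linarith
    have hq0 : 0 ≤ (∑ K, J ends p x y D K) := Finset.sum_nonneg (fun K _ => hJ0 D K)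
    calc (∑ K, J ends p x y D K) * expect p (fun ω => F₁ (clAway ends D x ω)) *
          ((∑ K, J ends p x y D K) * expect p (fun ω => F₂ (clAway ends D x ω)))
        = ((∑ K, J ends p x y D K) * (∑ K, J ends p x y D K)) *
          (expect p (fun ω => F₁ (clAway ends D x ω)) *
            expect p (fun ω => F₂ (clAway ends D x ω))) := by ring
      _ ≤ ((∑ K, J ends p x y D K) * (∑ K, J ends p x y D K)) *
          expect p (fun ω => F₁ (clAway ends D x ω) * F₂ (clAway ends D x ω)) :=
          mul_le_mul_of_nonneg_left hH' (mul_nonneg hq0 hq0)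
      _ = _ := by ring

/-- The conditional expectation of an `IncY` function is `AntiX`. -/
theorem antiX_condS (hp01 : ∀ e, 0 < p e ∧ p e < 1) (hxy : x ≠ y) {g : Set V → ℝ}
    (hg : IncY ends p x y g) : AntiX ends p x y (GibbsPAJoint.condS (J ends p x y) g) := by
  intro K K' hK hK' hKK'
  rw [condS_eq_expect ends p hp01 hxy g hK, condS_eq_expect ends p hp01 hxy g hK']
  apply expect_mono (isProbVec_of_interior p hp01)
  intro ω
  exact hg _ _ (clAway_mem_support_right ends p hp01 hxy hK' ω)
    (clAway_mem_support_right ends p hp01 hxy hK ω) (clAway_anti ends hKK' y ω)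

/-- The conditional expectation of an `AntiX` function is `IncY`. -/
theorem incY_condS_transpose (hp01 : ∀ e, 0 < p e ∧ p e < 1) (hxy : x ≠ y) {F : Set V → ℝ}
    (hF : AntiX ends p x y F) :
    IncY ends p x y (GibbsPAJoint.condS (GibbsPAJoint.transpose (J ends p x y)) F) := by
  intro D D' hD hD' hDD'
  rw [condS_transpose_eq_expect ends p hp01 hxy F hD,
    condS_transpose_eq_expect ends p hp01 hxy F hD']
  apply expect_mono (isProbVec_of_interior p hp01)
  intro ω
  exact hF _ _ (clAway_mem_support_left ends p hp01 hxy hD' ω)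
    (clAway_mem_support_left ends p hp01 hxy hD ω) (clAway_anti ends hDD' x ω)

end Separated

end SepPA

end Summit.Ventures.PercRepro2
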